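import Literature.Analysis.FluidPDE.FluidComputer.PumpCascade
import HarnessLib

/-!
# Fluid computer blueprint — the ROBUST pump cascade: noise tolerance in a stated norm (stable clocked blow-up)

HONEST FRAMING: low prior, high value-of-information experiment on Tao's machine paradigm; NOT a
claim that NS blows up. Nothing in this file constructs a cascade; every theorem is an implication
from a structure that, as far as anyone knows, is uninhabited for the true equations.

`PumpCascade.lean` types Tao's machine programme (J. Amer. Math. Soc. 29 (2016), §1.3) as one
`PumpGadget` per generation with input / output classes `In`, `Out ⊆ L²`, the context-free
realisation axiom `fires`, self-replication `replicate : Out n ⊆ In (n+1)`, and the spec sheet's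
energy floors and firing times. The blueprint's calibration (summit side,
`FluidComputerCalibrationPump.lean`, `exists_pumpCascade_of_clockedProfile`) showed that, AS TYPED,
that interface cannot tell a machine from a single dyadically clocked blow-up orbit: `In` and `Out`
are arbitrary sets, so one orbit is an admissible "class", and robustness — the property Tao
singles out as the mathematical heart of the programme ("to arrive at (and rigorously certify) a
design for logical gates of inviscid fluid that has some good noise tolerance properties", §1.3;
"This replication process is stable with respect to perturbations", §1.3) — is invisible.

This file adds the one field that restores it, in a STATED norm:

* `scaledSobolevNorm s κ f = (∫ (1 + |ξ|²/κ²)^s |f̂(ξ)|² dξ)^{1/2}` — the inhomogeneous Sobolev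
  norm of order `s` measured in units of the frequency scale `κ` (`s = 0`: the `L²` norm,
  `scaledSobolevNorm_zero`; `κ = 1`: the plain `H^s` norm, `scaledSobolevNorm_one`; monotone in
  `s`; for `κ ≥ 1`, `s ≥ 0` dominated by the `H^s` norm, `scaledSobolevNorm_le_eFourierSobolevNorm`,
  so its balls are `H^s`-open);
* `RobustPumpCascade S s ρ` — a `PumpCascade S` whose generation-`(n+1)` input class contains,
  around EVERY output state `v` of generation `n`, all `H¹⁰_df` states `w` with
  `‖w - v‖_{X^s at scale λ_{n+1}} < ρ √E_{n+1}` (`margin`: relative noise tolerance `ρ`, uniformly in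
  the generation, in rescaled units), and whose generation-`0` input class contains the same ball
  around the ignition datum (`igniteBall`). For `ρ ≤ 0` the two fields are vacuous and nothing is
  added; the content is at `ρ > 0`.

Calibration of the exponent `s`: Tao's own stability assertion for the averaged equation is in the
`H¹⁰_df` norm — "Our analysis is in fact somewhat stable, and will also apply if `u₀` is a
sufficiently small perturbation of `ψ_{1,n₀}` in the `H¹⁰_df` norm, thus creating blowup for a
non-empty open set of initial data in smooth topologies" (§4, footnote to the choice of data) — i.e.
`s = 10` at scale `λ₀`; `s = 0` (energy-norm tolerance of noise at ALL finer scales) is a far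
stronger demand. The blueprint's `ASSEMBLY.md` §2d discusses which `s` the cell's numerics probe.

Proved here (soft, unconditional given the structure):
* `CascadeSpecs.shift` — the spec sheet seen from generation `k` (`λ₀ ↦ λ_k`, `E₀ ↦ E_k`), with
  `shift_lam`, `shift_Tmax`, `shift_Emin`, and the tail identity
  `∑_{m<k} T_m + T_*(shift k) = T_*` (`sum_add_shift_Tstar`), `T_*(shift k) ≤ T_*`;
* `RobustPumpCascade.reseed` — replacing the ignition datum by ANY divergence-free Schwartz
  `H¹⁰_df` datum in the ignition ball gives a `PumpCascade S`; hence **stable blow-up**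
  `lifespan_le_of_near`: every mild Navier–Stokes trajectory from every such datum lives at most
  `T_*` (`α > 0`, `η > 1/4`) — an `X^s`-BALL of blow-up data, which no soft argument extracts from a
  single blow-up orbit (local well-posedness makes the lifespan lower semicontinuous, never upper);
* `RobustPumpCascade.reseedAt` / `lifespan_le_of_near_output` — the same at every generation:
  every divergence-free Schwartz `H¹⁰_df` datum within `ρ√E_{k+1}` (scale `λ_{k+1}`) of an output
  state of generation `k` runs the TAIL cascade `PumpCascade (S.shift (k+1))` and lives at most
  `T_*(shift (k+1)) = ∑_{m>k} T_m`;
* `RobustPumpCascade.weaken` / `ofNonpos` — calibration of the parameters: tolerance in `X^s`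
  implies tolerance in `X^{s'}`, `s ≤ s'`, and with any smaller radius (so `s = 0` is the strongest,
  `s = 10` the weakest demand among `0 ≤ s ≤ 10`); for `ρ ≤ 0` EVERY pump cascade is `ρ`-robust
  (the content is exactly at `ρ > 0`);
* `RobustPumpCascade.canonical` — WLOG the input classes are minimal,
  `In (n+1) = Out n ∪ (N_ρ(Out n) ∩ H¹⁰_df)` (`canonIn`): `In` carries no information beyond the
  hand-off classes `Out n` and `ρ`;
* `RobustPumpCascade.no_longLived_near` — contrapositive: no robust pump cascade (`α > 0`, `η > 1/4`)
  is seeded within `ρ√E₀` of a datum having a mild solution that lives past `T_*`. So wherever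
  blow-up (if any) is UNSTABLE, the single-orbit inhabitant of `PumpCascade S` built by the
  calibration converse is not robust: the converse fails for `RobustPumpCascade`, as it should.

## References

* T. Tao, *Finite time blowup for an averaged three-dimensional Navier–Stokes equation*, J. Amer.
  Math. Soc. 29 (2016) 601–674, arXiv:1402.0290v3: §1.3 (noise tolerance; "stable with respect to
  perturbations"), §4 footnote (stability in `H¹⁰_df`, open set of blow-up data), Prop. 6.3
  (vii)–(ix). [Tao2016AveragedNS]
* H. Bahouri, J.-Y. Chemin, R. Danchin, *Fourier Analysis and Nonlinear PDE*, Springer 2011,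
  §1.4.1 (inhomogeneous Sobolev norms). [BahouriCheminDanchin2011]
-/

noncomputable section

open MeasureTheory Set Filter Topology
open scoped ENNReal NNReal SchwartzMap

namespace Literature.Analysis.FluidPDE.FluidComputer

open Literature.Analysis.FluidPDE.Tao2016
open Literature.Analysis.FunctionSpaces (eFourierSobolevNorm)

/-! ### The scale-adapted Sobolev norm -/

/-- The **scale-adapted inhomogeneous Sobolev norm** of order `s` at frequency scale `κ`:
`‖f‖_{X^s_κ} = (∫ (1 + |ξ|²/κ²)^s |f̂(ξ)|² dξ)^{1/2}` — the `H^s` norm with frequencies measured in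
units of `κ` (Bahouri–Chemin–Danchin 2011, §1.4.1, at `κ = 1`). [cite: BahouriCheminDanchin2011, §1.4.1] -/
def scaledSobolevNorm (s κ : ℝ) (f : L2C) : ℝ≥0∞ :=
  (∫⁻ ξ, ENNReal.ofReal ((1 + ‖ξ‖ ^ 2 / κ ^ 2) ^ s) * ‖fourierFn f ξ‖ₑ ^ 2) ^ (1 / 2 : ℝ)

/-- At scale `κ = 1` the scale-adapted norm IS the `H^s` norm `eFourierSobolevNorm s`. [cite: BahouriCheminDanchin2011, §1.4.1] -/
theorem scaledSobolevNorm_one (s : ℝ) (f : L2C) :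
    scaledSobolevNorm s 1 f = eFourierSobolevNorm s f := by
  simp only [scaledSobolevNorm, FunctionSpaces.eFourierSobolevNorm, fourierFn, one_pow, div_one]

/-- At order `s = 0` the scale-adapted norm is the `L²` norm, at every scale (Plancherel). [cite: BahouriCheminDanchin2011, Thm. 1.24] -/
theorem scaledSobolevNorm_zero (κ : ℝ) (f : L2C) : scaledSobolevNorm 0 κ f = ‖f‖ₑ := by
  rw [← FunctionSpaces.eFourierSobolevNorm_zero_eq_enorm f]
  simp only [scaledSobolevNorm, FunctionSpaces.eFourierSobolevNorm, fourierFn, Real.rpow_zero]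

/-- The scale-adapted norms increase with the order `s` (the weight `1 + |ξ|²/κ²` is `≥ 1`). [cite: BahouriCheminDanchin2011, §1.4.1] -/
theorem scaledSobolevNorm_mono_order {s s' : ℝ} (h : s ≤ s') (κ : ℝ) (f : L2C) :
    scaledSobolevNorm s κ f ≤ scaledSobolevNorm s' κ f := by
  unfold scaledSobolevNorm
  refine ENNReal.rpow_le_rpow (lintegral_mono fun ξ => ?_) (by norm_num)
  refine mul_le_mul' (ENNReal.ofReal_le_ofReal ?_) le_rfl
  have h1 : (1 : ℝ) ≤ 1 + ‖ξ‖ ^ 2 / κ ^ 2 := by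
    have := div_nonneg (sq_nonneg ‖ξ‖) (sq_nonneg κ); linarith
  exact Real.rpow_le_rpow_of_exponent_le h1 h

/-- The `L²` norm is below every scale-adapted norm of order `s ≥ 0`. [cite: BahouriCheminDanchin2011, §1.4.1] -/
theorem enorm_le_scaledSobolevNorm {s : ℝ} (hs : 0 ≤ s) (κ : ℝ) (f : L2C) :
    ‖f‖ₑ ≤ scaledSobolevNorm s κ f := by
  rw [← scaledSobolevNorm_zero κ f]
  exact scaledSobolevNorm_mono_order hs κ f

/-- For scales `κ ≥ 1` and orders `s ≥ 0` the scale-adapted norm is dominated by the plain `H^s`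
norm (`1 + |ξ|²/κ² ≤ 1 + |ξ|²`); in particular `X^s_κ`-balls are `H^s`-open. [cite: BahouriCheminDanchin2011, §1.4.1] -/
theorem scaledSobolevNorm_le_eFourierSobolevNorm {s κ : ℝ} (hs : 0 ≤ s) (hκ : 1 ≤ κ) (f : L2C) :
    scaledSobolevNorm s κ f ≤ eFourierSobolevNorm s f := by
  rw [← scaledSobolevNorm_one]
  unfold scaledSobolevNorm
  refine ENNReal.rpow_le_rpow (lintegral_mono fun ξ => ?_) (by norm_num)
  refine mul_le_mul' (ENNReal.ofReal_le_ofReal ?_) le_rfl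
  have hκ2 : (1 : ℝ) ≤ κ ^ 2 := by nlinarith
  have h0 : (0 : ℝ) ≤ 1 + ‖ξ‖ ^ 2 / κ ^ 2 := by
    have := div_nonneg (sq_nonneg ‖ξ‖) (sq_nonneg κ); linarith
  refine Real.rpow_le_rpow h0 ?_ hs
  rw [one_pow, div_one]
  linarith [div_le_self (sq_nonneg ‖ξ‖) hκ2]

/-! ### The spec sheet seen from generation `k` -/

namespace CascadeSpecs

variable (S : CascadeSpecs)

/-- The spec sheet **shifted to generation `k`**: base frequency `λ_k`, base energy `E_k = E₀ηᵏ`,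
same `C`, `α`, `η` (the tail of a dyadic cascade is a dyadic cascade). [folklore] -/
def shift (k : ℕ) : CascadeSpecs where
  lam0 := S.lam k
  C := S.C
  alpha := S.alpha
  E0 := S.Emin k
  eta := S.eta
  lam0_pos := S.lam_pos k
  C_pos := S.C_pos
  E0_pos := S.Emin_pos k
  eta_pos := S.eta_pos
  eta_le_one := S.eta_le_one

/-- The shifted sheet's base frequency is `λ_k`. [folklore] -/
@[simp] theorem shift_lam0 (k : ℕ) : (S.shift k).lam0 = S.lam k := rfl
/-- The shifted sheet keeps the time constant `C`. [folklore] -/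
@[simp] theorem shift_C (k : ℕ) : (S.shift k).C = S.C := rfl
/-- The shifted sheet keeps the abruptness exponent `α`. [folklore] -/
@[simp] theorem shift_alpha (k : ℕ) : (S.shift k).alpha = S.alpha := rfl
/-- The shifted sheet's base energy is the floor `E_k = E₀ηᵏ`. [folklore] -/
@[simp] theorem shift_E0 (k : ℕ) : (S.shift k).E0 = S.Emin k := rfl
/-- The shifted sheet keeps the efficiency `η`. [folklore] -/
@[simp] theorem shift_eta (k : ℕ) : (S.shift k).eta = S.eta := rfl

/-- The frequencies of the shifted sheet: `λ_m(shift k) = λ_{k+m}`. [folklore] -/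
@[simp] theorem shift_lam (k m : ℕ) : (S.shift k).lam m = S.lam (k + m) := by
  simp only [lam, shift_lam0, pow_add, mul_assoc]

/-- The transfer-time allowances of the shifted sheet: `T_m(shift k) = T_{k+m}`. [folklore] -/
@[simp] theorem shift_Tmax (k m : ℕ) : (S.shift k).Tmax m = S.Tmax (k + m) := by
  simp only [Tmax, shift_C, shift_lam, shift_alpha]

/-- The energy floors of the shifted sheet: `E_m(shift k) = E_{k+m}`. [folklore] -/
@[simp] theorem shift_Emin (k m : ℕ) : (S.shift k).Emin m = S.Emin (k + m) := by
  simp only [Emin, shift_E0, shift_eta, pow_add, mul_assoc]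

/-- The time budget of the shifted sheet is the tail sum `∑_m T_{k+m}`. [folklore] -/
theorem shift_Tstar (k : ℕ) : (S.shift k).Tstar = ∑' m, S.Tmax (m + k) := by
  unfold Tstar
  exact tsum_congr fun m => by rw [shift_Tmax, add_comm]

/-- **Tail identity**: `∑_{m<k} T_m + T_*(shift k) = T_*` (`α > 0`). [folklore] -/
theorem sum_add_shift_Tstar (hα : 0 < S.alpha) (k : ℕ) :
    ∑ m ∈ Finset.range k, S.Tmax m + (S.shift k).Tstar = S.Tstar := by
  rw [shift_Tstar]
  exact (S.summable_Tmax hα).sum_add_tsum_nat_add k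

/-- The tail budget is at most the whole budget: `T_*(shift k) ≤ T_*` (`α > 0`). [folklore] -/
theorem shift_Tstar_le (hα : 0 < S.alpha) (k : ℕ) : (S.shift k).Tstar ≤ S.Tstar := by
  rw [← S.sum_add_shift_Tstar hα k]
  exact le_add_of_nonneg_left (Finset.sum_nonneg fun m _ => S.Tmax_nonneg m)

end CascadeSpecs

/-! ### The robust pump cascade -/

/-- **A robust pump cascade** realising the spec sheet `S` in the TRUE Navier–Stokes equations
with **noise tolerance `ρ` in the scale-adapted norm of order `s`**: a `PumpCascade S` (gadgets
`G n` at scales `λ_n`, context-free `fires`, `replicate`, energy floors `E₀ηⁿ`, firing times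
`≤ Cλ_n^{-α}`, ignition datum `u₀`) such that

* `margin` — TOLERANCE, uniformly in the generation and in rescaled units (idea-bound: Tao's
  "noise-tolerant" gates, §1.3): every `H¹⁰_df` state within `X^s`-distance `ρ√E_{n+1}` (frequencies
  in units of `λ_{n+1}`) of ANY output state of generation `n` is an input state of generation
  `n+1` — the next machine runs on the designed hand-off plus that much noise;
* `igniteBall` — the same ball around the ignition datum lies in the generation-`0` input class.

For `ρ ≤ 0` both fields are vacuous. For `ρ > 0` a single orbit is no longer an admissible input
class: the interface now types STABLE clocked blow-up (`RobustPumpCascade.lifespan_le_of_near`,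
`lifespan_le_of_near_output`), Tao's §4-footnote assertion for the averaged equation transposed to
the true one. Nothing asserts such a cascade exists. [cite: Tao2016AveragedNS, §1.3 pp. 10–11] -/
structure RobustPumpCascade (S : CascadeSpecs) (s ρ : ℝ) extends PumpCascade S where
  /-- TOLERANCE (idea-bound): the `X^s_{λ_{n+1}}`-ball of radius `ρ√E_{n+1}` around every output
  state of generation `n`, within `H¹⁰_df`, consists of input states of generation `n+1` -/
  margin : ∀ n : ℕ, ∀ v ∈ (G n).Out, ∀ w : L2C, MemH10df w →
    scaledSobolevNorm s (S.lam (n + 1)) (w - v) < ENNReal.ofReal (ρ * Real.sqrt (S.Emin (n + 1))) →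
      w ∈ (G (n + 1)).In
  /-- IGNITION WITH TOLERANCE: the same ball around the ignition datum consists of generation-`0`
  input states -/
  igniteBall : ∀ w : L2C, MemH10df w →
    scaledSobolevNorm s (S.lam 0) (w - schwartzL2 u₀) < ENNReal.ofReal (ρ * Real.sqrt (S.Emin 0)) →
      w ∈ (G 0).In

namespace RobustPumpCascade

variable {S : CascadeSpecs} {s ρ : ℝ} (R : RobustPumpCascade S s ρ)

/-- **Re-seeding.** Any divergence-free Schwartz `H¹⁰_df` datum in the ignition ball of a robust
pump cascade ignites the same library of gadgets: a `PumpCascade S` with that datum. [cite: Tao2016AveragedNS, §4 footnote (stability in H^10_df)] -/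
def reseed (w₀ : 𝓢(EuclideanSpace ℝ (Fin 3), EuclideanSpace ℝ (Fin 3)))
    (hdiv : VectorCalculus.IsDivFree ⇑w₀) (h10 : MemH10df (schwartzL2 w₀))
    (hnear : scaledSobolevNorm s (S.lam 0) (schwartzL2 w₀ - schwartzL2 R.u₀) <
      ENNReal.ofReal (ρ * Real.sqrt (S.Emin 0))) :
    PumpCascade S :=
  { R.toPumpCascade with
    u₀ := w₀
    divFree := hdiv
    memH10df := h10
    ignite := R.igniteBall _ h10 hnear }

/-- The re-seeded cascade's ignition datum is the new datum. [folklore] -/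
@[simp] theorem reseed_u₀ (w₀ : 𝓢(EuclideanSpace ℝ (Fin 3), EuclideanSpace ℝ (Fin 3)))
    (hdiv : VectorCalculus.IsDivFree ⇑w₀) (h10 : MemH10df (schwartzL2 w₀))
    (hnear : scaledSobolevNorm s (S.lam 0) (schwartzL2 w₀ - schwartzL2 R.u₀) <
      ENNReal.ofReal (ρ * Real.sqrt (S.Emin 0))) :
    (R.reseed w₀ hdiv h10 hnear).u₀ = w₀ := rfl

/-- Re-seeding keeps the library of gadgets. [folklore] -/
@[simp] theorem reseed_G (w₀ : 𝓢(EuclideanSpace ℝ (Fin 3), EuclideanSpace ℝ (Fin 3)))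
    (hdiv : VectorCalculus.IsDivFree ⇑w₀) (h10 : MemH10df (schwartzL2 w₀))
    (hnear : scaledSobolevNorm s (S.lam 0) (schwartzL2 w₀ - schwartzL2 R.u₀) <
      ENNReal.ofReal (ρ * Real.sqrt (S.Emin 0))) :
    (R.reseed w₀ hdiv h10 hnear).G = R.G := rfl

/-- **Stable blow-up (lifespan form).** In a robust pump cascade with `α > 0`, `η > 1/4`, EVERY
`H¹⁰_df`-mild Navier–Stokes trajectory from EVERY divergence-free Schwartz `H¹⁰_df` datum within
`X^s_{λ₀}`-distance `ρ√E₀` of the ignition datum lives at most `T_* = ∑ Cλ_n^{-α}`: an OPEN BALL of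
blow-up data. HONEST FRAMING: an implication from an uninhabited-as-far-as-known structure. [cite: Tao2016AveragedNS, §4 footnote (open set of blow-up data)] -/
theorem lifespan_le_of_near (hα : 0 < S.alpha) (hη : 1 / 4 < S.eta)
    (w₀ : 𝓢(EuclideanSpace ℝ (Fin 3), EuclideanSpace ℝ (Fin 3)))
    (hdiv : VectorCalculus.IsDivFree ⇑w₀) (h10 : MemH10df (schwartzL2 w₀))
    (hnear : scaledSobolevNorm s (S.lam 0) (schwartzL2 w₀ - schwartzL2 R.u₀) <
      ENNReal.ofReal (ρ * Real.sqrt (S.Emin 0)))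
    {S' : ℝ} {u : ℝ → L2C} (hu : IsMildSolutionFor eulerForm (schwartzL2 w₀) (Ico 0 S') u) :
    S' ≤ S.Tstar :=
  (R.reseed w₀ hdiv h10 hnear).lifespan_le hα hη hu

/-- **No long-lived neighbours** (the calibration converse FAILS for the robust interface): a
robust pump cascade with `α > 0`, `η > 1/4` cannot be seeded within `X^s_{λ₀}`-distance `ρ√E₀` of a
divergence-free Schwartz `H¹⁰_df` datum having an `H¹⁰_df`-mild Navier–Stokes solution on `[0,S')`
with `S' > T_*`. So wherever blow-up (if any) is unstable — accumulated by long-lived data — the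
single-orbit inhabitant of `PumpCascade S` is not a `RobustPumpCascade S s ρ`, `ρ > 0`. [cite: Tao2016AveragedNS, §4 footnote (open set of blow-up data)] -/
theorem no_longLived_near (hα : 0 < S.alpha) (hη : 1 / 4 < S.eta)
    (w₀ : 𝓢(EuclideanSpace ℝ (Fin 3), EuclideanSpace ℝ (Fin 3)))
    (hdiv : VectorCalculus.IsDivFree ⇑w₀) (h10 : MemH10df (schwartzL2 w₀))
    (hnear : scaledSobolevNorm s (S.lam 0) (schwartzL2 w₀ - schwartzL2 R.u₀) <
      ENNReal.ofReal (ρ * Real.sqrt (S.Emin 0)))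
    {S' : ℝ} (hS' : S.Tstar < S') {u : ℝ → L2C}
    (hu : IsMildSolutionFor eulerForm (schwartzL2 w₀) (Ico 0 S') u) : False :=
  absurd (R.lifespan_le_of_near hα hη w₀ hdiv h10 hnear hu) (not_le.2 hS')

/-- **Re-seeding at generation `k+1`.** A divergence-free Schwartz `H¹⁰_df` datum within
`X^s_{λ_{k+1}}`-distance `ρ√E_{k+1}` of an output state of generation `k` ignites the TAIL of the
library: a `PumpCascade (S.shift (k+1))` whose generation-`m` gadget is `G (k+1+m)`. [cite: Tao2016AveragedNS, §1.3 pp. 10–11] -/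
def reseedAt (k : ℕ) {v : L2C} (hv : v ∈ (R.G k).Out)
    (w₀ : 𝓢(EuclideanSpace ℝ (Fin 3), EuclideanSpace ℝ (Fin 3)))
    (hdiv : VectorCalculus.IsDivFree ⇑w₀) (h10 : MemH10df (schwartzL2 w₀))
    (hnear : scaledSobolevNorm s (S.lam (k + 1)) (schwartzL2 w₀ - v) <
      ENNReal.ofReal (ρ * Real.sqrt (S.Emin (k + 1)))) :
    PumpCascade (S.shift (k + 1)) where
  G m := R.G (k + 1 + m)
  scale m := by rw [CascadeSpecs.shift_lam]; exact R.scale _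
  replicate m := R.replicate (k + 1 + m)
  energy m := by rw [CascadeSpecs.shift_Emin]; exact R.energy _
  time m := by rw [CascadeSpecs.shift_Tmax]; exact R.time _
  u₀ := w₀
  divFree := hdiv
  memH10df := h10
  ignite := R.margin k v hv _ h10 hnear

/-- **Stable blow-up at every generation.** In a robust pump cascade with `α > 0`, `η > 1/4`, every
`H¹⁰_df`-mild Navier–Stokes trajectory from every divergence-free Schwartz `H¹⁰_df` datum within
`X^s_{λ_{k+1}}`-distance `ρ√E_{k+1}` of ANY output state of generation `k` lives at most the tail
budget `T_*(shift (k+1)) = ∑_{m>k} Cλ_m^{-α}` (`≤ T_*`, `CascadeSpecs.shift_Tstar_le`): the set of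
blow-up data contains a ball, of radius `ρ√E_{k+1}` in rescaled units, around every state the
cascade hands on — uniform-in-generation stability, the typed noise tolerance. [cite: Tao2016AveragedNS, §1.3 pp. 10–11] -/
theorem lifespan_le_of_near_output (hα : 0 < S.alpha) (hη : 1 / 4 < S.eta) (k : ℕ) {v : L2C}
    (hv : v ∈ (R.G k).Out) (w₀ : 𝓢(EuclideanSpace ℝ (Fin 3), EuclideanSpace ℝ (Fin 3)))
    (hdiv : VectorCalculus.IsDivFree ⇑w₀) (h10 : MemH10df (schwartzL2 w₀))
    (hnear : scaledSobolevNorm s (S.lam (k + 1)) (schwartzL2 w₀ - v) <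
      ENNReal.ofReal (ρ * Real.sqrt (S.Emin (k + 1))))
    {S' : ℝ} {u : ℝ → L2C} (hu : IsMildSolutionFor eulerForm (schwartzL2 w₀) (Ico 0 S') u) :
    S' ≤ (S.shift (k + 1)).Tstar :=
  (R.reseedAt k hv w₀ hdiv h10 hnear).lifespan_le (by simpa using hα) (by simpa using hη) hu

/-- **X5a near the seed**, conditional on the two named standard facts of `CascadeWitness.lean`
(all clauses proved in the tree): every divergence-free Schwartz `H¹⁰_df` datum in the ignition
ball of a robust pump cascade (`α > 0`, `η > 1/4`) yields the classical blow-up object X5a. [cite: Tao2016AveragedNS, §4 footnote (open set of blow-up data)] -/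
theorem x5a_of_near (hth : H10MildTheory) (hblow : MildMaximalGivesBlowup)
    (hα : 0 < S.alpha) (hη : 1 / 4 < S.eta)
    (w₀ : 𝓢(EuclideanSpace ℝ (Fin 3), EuclideanSpace ℝ (Fin 3)))
    (hdiv : VectorCalculus.IsDivFree ⇑w₀) (h10 : MemH10df (schwartzL2 w₀))
    (hnear : scaledSobolevNorm s (S.lam 0) (schwartzL2 w₀ - schwartzL2 R.u₀) <
      ENNReal.ofReal (ρ * Real.sqrt (S.Emin 0))) :
    ∃ ν : ℝ, 0 < ν ∧ ∃ T : ℝ, 0 < T ∧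
      ∃ (u : ℝ → EuclideanSpace ℝ (Fin 3) → EuclideanSpace ℝ (Fin 3))
        (p : ℝ → EuclideanSpace ℝ (Fin 3) → ℝ),
        IsMaximalSmoothSolution ν 0 u p T ∧ IsLerayHopfOn T ν 0 (u 0) u ∧ HasRapidSpatialDecay (u 0) :=
  (R.reseed w₀ hdiv h10 hnear).x5a hth hblow hα hη

/-- **Norm blow-up near the seed**: with `H10MildTheory`, every divergence-free Schwartz `H¹⁰_df`
datum `w₀` in the ignition ball has a maximal mild Navier–Stokes solution on some `[0,S_m)`,
`S_m ≤ T_*`, with unbounded `H¹⁰` norm. [cite: Tao2016AveragedNS, §4 footnote (open set of blow-up data)] -/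
theorem normBlowup_of_near (hth : H10MildTheory) (hα : 0 < S.alpha) (hη : 1 / 4 < S.eta)
    (w₀ : 𝓢(EuclideanSpace ℝ (Fin 3), EuclideanSpace ℝ (Fin 3)))
    (hdiv : VectorCalculus.IsDivFree ⇑w₀) (h10 : MemH10df (schwartzL2 w₀))
    (hnear : scaledSobolevNorm s (S.lam 0) (schwartzL2 w₀ - schwartzL2 R.u₀) <
      ENNReal.ofReal (ρ * Real.sqrt (S.Emin 0))) :
    ∃ Sm : ℝ, 0 < Sm ∧ Sm ≤ S.Tstar ∧ ∃ U : ℝ → L2C,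
      IsMildSolutionFor eulerForm (schwartzL2 w₀) (Ico 0 Sm) U ∧
      ∀ C : ℝ, ∃ t ∈ Ico 0 Sm, ENNReal.ofReal C < eFourierSobolevNorm 10 (U t) :=
  (R.reseed w₀ hdiv h10 hnear).normBlowup hth hα hη

/-! ### Calibration of the parameters `s`, `ρ` -/

/-- **The ladder of demands.** Tolerance in a norm of LOWER order, or with a LARGER relative radius,
is the stronger requirement: an `X^s`-ball contains the `X^{s'}`-ball of the same radius for
`s ≤ s'` (`scaledSobolevNorm_mono_order`), and a larger radius a smaller one. So
`RobustPumpCascade S s ρ → RobustPumpCascade S s' ρ'` for `s ≤ s'`, `ρ' ≤ ρ`; among `0 ≤ s ≤ 10`,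
`s = 0` (energy-norm noise at all scales) is the strongest and `s = 10` (Tao's `H¹⁰_df` class,
§4 footnote) the weakest demand. [cite: Tao2016AveragedNS, §4 footnote (stability in H^10_df)] -/
def weaken {s' ρ' : ℝ} (hs : s ≤ s') (hρ : ρ' ≤ ρ) : RobustPumpCascade S s' ρ' where
  toPumpCascade := R.toPumpCascade
  margin n v hv w hw hlt :=
    R.margin n v hv w hw ((scaledSobolevNorm_mono_order hs _ _).trans_lt (hlt.trans_le
      (ENNReal.ofReal_le_ofReal (mul_le_mul_of_nonneg_right hρ (Real.sqrt_nonneg _)))))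
  igniteBall w hw hlt :=
    R.igniteBall w hw ((scaledSobolevNorm_mono_order hs _ _).trans_lt (hlt.trans_le
      (ENNReal.ofReal_le_ofReal (mul_le_mul_of_nonneg_right hρ (Real.sqrt_nonneg _)))))

/-- Weakening keeps the underlying pump cascade (gadgets and ignition datum). [folklore] -/
@[simp] theorem weaken_toPumpCascade {s' ρ' : ℝ} (hs : s ≤ s') (hρ : ρ' ≤ ρ) :
    (R.weaken hs hρ).toPumpCascade = R.toPumpCascade := rfl

/-- **Non-positive tolerance is no tolerance**: for `ρ ≤ 0` the radius `ρ√E` is `0` in `ℝ≥0∞`,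
the fields `margin` / `igniteBall` are vacuous, and EVERY pump cascade is `ρ`-robust — in
particular the single-orbit inhabitants of the calibration converse. The content of
`RobustPumpCascade S s ρ` is exactly at `ρ > 0`. [folklore] -/
def ofNonpos (L : PumpCascade S) (hρ : ρ ≤ 0) : RobustPumpCascade S s ρ where
  toPumpCascade := L
  margin n v hv w hw hlt := by
    rw [ENNReal.ofReal_of_nonpos (mul_nonpos_iff.2 (Or.inr ⟨hρ, Real.sqrt_nonneg _⟩))] at hlt
    exact absurd hlt ENNReal.not_lt_zero
  igniteBall w hw hlt := by
    rw [ENNReal.ofReal_of_nonpos (mul_nonpos_iff.2 (Or.inr ⟨hρ, Real.sqrt_nonneg _⟩))] at hlt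
    exact absurd hlt ENNReal.not_lt_zero

/-- `ofNonpos` keeps the pump cascade. [folklore] -/
@[simp] theorem ofNonpos_toPumpCascade (L : PumpCascade S) (hρ : ρ ≤ 0) :
    (ofNonpos (s := s) L hρ).toPumpCascade = L := rfl

/-! ### Minimal input classes: `In` carries no information beyond `Out` and `ρ` -/

/-- The **canonical (minimal) input classes** of a robust pump cascade: generation `0` accepts the
ignition datum and the `H¹⁰_df` part of its `X^s_{λ₀}`-ball of radius `ρ√E₀`; generation `n+1`
accepts the output class of generation `n` and the `H¹⁰_df` part of its `X^s_{λ_{n+1}}`-neighbourhood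
of radius `ρ√E_{n+1}` — nothing else. [folklore] -/
def canonIn : ℕ → Set L2C
  | 0 => {w | w = schwartzL2 R.u₀ ∨ (MemH10df w ∧
      scaledSobolevNorm s (S.lam 0) (w - schwartzL2 R.u₀) < ENNReal.ofReal (ρ * Real.sqrt (S.Emin 0)))}
  | n + 1 => {w | w ∈ (R.G n).Out ∨ (MemH10df w ∧ ∃ v ∈ (R.G n).Out,
      scaledSobolevNorm s (S.lam (n + 1)) (w - v) < ENNReal.ofReal (ρ * Real.sqrt (S.Emin (n + 1))))}

/-- The canonical input classes lie inside the given ones (`ignite`/`igniteBall` at generation `0`,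
`replicate`/`margin` at generation `n+1`). [folklore] -/
theorem canonIn_subset : ∀ n, R.canonIn n ⊆ (R.G n).In
  | 0 => by
    rintro w (rfl | ⟨hw, hlt⟩)
    · exact R.ignite
    · exact R.igniteBall w hw hlt
  | n + 1 => by
    rintro w (hv | ⟨hw, v, hv, hlt⟩)
    · exact R.replicate n hv
    · exact R.margin n v hv w hw hlt

/-- **Canonical form.** Shrinking every input class to the canonical one keeps a robust pump cascade
(same gadgets otherwise, same output classes, floors, times, ignition datum): `fires` and `in_floor`
only get easier on a smaller `In`, and `replicate`, `margin`, `ignite`, `igniteBall` hold by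
construction. So WLOG `In (n+1) = Out n ∪ (N_ρ(Out n) ∩ H¹⁰_df)`: the free data of a robust pump
cascade are the hand-off classes `Out n`, the datum and the numbers, and the interface says exactly
that the `ρ`-neighbourhood chain of the hand-off classes is captured and fired forward on the clock
by the Navier–Stokes flow — a uniformly stable clocked blow-up, no more and no less. [folklore] -/
def canonical : RobustPumpCascade S s ρ where
  G n :=
    { R.G n with
      In := R.canonIn n
      in_floor := fun v hv => (R.G n).in_floor v (R.canonIn_subset n hv)
      fires := fun a S' u hu t ht hin hlt => (R.G n).fires a S' u hu t ht (R.canonIn_subset n hin) hlt }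
  scale n := R.scale n
  replicate _ := fun _ hv => Or.inl hv
  energy n := R.energy n
  time n := R.time n
  u₀ := R.u₀
  divFree := R.divFree
  memH10df := R.memH10df
  ignite := Or.inl rfl
  margin _ v hv _ hw hlt := Or.inr ⟨hw, v, hv, hlt⟩
  igniteBall _ hw hlt := Or.inr ⟨hw, hlt⟩

/-- The canonical form has the canonical (minimal) input classes. [folklore] -/
@[simp] theorem canonical_In (n : ℕ) : (R.canonical.G n).In = R.canonIn n := rfl

/-- The canonical form keeps the output (hand-off) classes. [folklore] -/
@[simp] theorem canonical_Out (n : ℕ) : (R.canonical.G n).Out = (R.G n).Out := rfl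

/-- The canonical form keeps the ignition datum. [folklore] -/
@[simp] theorem canonical_u₀ : R.canonical.u₀ = R.u₀ := rfl

/-- The canonical input classes are contained in the original ones, generation by generation. [folklore] -/
theorem canonical_In_subset (n : ℕ) : (R.canonical.G n).In ⊆ (R.G n).In := R.canonIn_subset n

end RobustPumpCascade

end Literature.Analysis.FluidPDE.FluidComputer

end
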